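import Summits.QuantumFields.QCD.Theorems.SpectralDefectExtinctionWindowExtinctionChessboardDefs
import Summits.QuantumFields.QCD.Theorems.WindowExtinction.Negative.SpectralFlowLocal
import Summits.QuantumFields.QCD.Theorems.SpectralDefectExtinctionTipNoBindingStubPositivity

/-!
# Crux `WindowExtinction` (item stmt-QuantumFields-8964), line `chessboard-cold-cells`:
# the deterministic core of `stub_deep` (S5) — sub-level counting by supports

Helper file for the registered stub `stub_deep` ("deep extinction from flat-block large deviations").
The localisation step of the deep count is done WITHOUT an IMS partition of unity, by linear algebra on
supports:

* `countP_lt_le_card_of_support` (generic, Hermitian `A`): if every non-zero vector `v` with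
  `Re⟨v, Av⟩ ≤ E‖v‖²` has a non-zero coordinate in the finite index set `X`, then `A` has at most `|X|`
  eigenvalues below `E` (the spectral subspace below `E` injects into `ℂ^X` by restriction);
* `deep_dirichletForm_eq_re_form`, `re_form_hermitianPart_wilsonDirac`,
  `posSemidef_add_conjTranspose_wilsonDirac`: the covariant Wilson energy of the line IS
  `Re⟨ψ, D_W(U,0,1)ψ⟩ = ⟨ψ, ½(D + Dᴴ)ψ⟩` (tree `stub_positivity`), so `D + Dᴴ ⪰ 0`;
* `hermitianCount_le_of_dichotomy`: given the flat-cube dichotomy (S4, as a hypothesis), the number of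
  eigenvalues of `Re D_W(U,0,1)` below `λ` is at most `12 (n+1)⁴ ·#{t : the block t + {0,…,n}⁴ holds
  ≥ n⁴/128 lowest corners of λ-flat cubes}` — take `X` = all colour–spin indices over the union of the
  flat-rich blocks: a sub-level vector vanishing on `X` would contradict the dichotomy's support clause;
* `realCount_le_of_kyFan_dichotomy`: with Ky Fan counting (S4b, as a hypothesis) the number of REAL
  roots of `charpoly D_W(U,0,1)` below `η` is at most `24 (n+1)⁴ · #{flat-rich positions at level 2η}`
  (`128 n² η ≤ 1`).
-/

noncomputable section

namespace Summit.QuantumFields.QCD.Cruxes.WindowExtinction.ChessboardColdCells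

open scoped BigOperators Matrix ComplexConjugate Classical ComplexOrder
open Matrix
open Literature.MathematicalPhysics Literature.MathematicalPhysics.QuantumLattice
  Literature.MathematicalPhysics.QuantumFieldTheory Literature.Probability.LatticeModels
open Summit.QuantumFields.QCD.Theorems.ExtinctionBuildsQCD.Negative (re_form_eq_sum_eigenvalues)
open Summit.QuantumFields.QCD.Theorems.WindowExtinction.Negative (countP_roots_eq_card_filter
  sum_norm_sq_eigenvectorUnitary_conjTranspose_mulVec)
open Summit.QuantumFields.QCD.Cruxes.TipNoBinding.PositivityNoLeakSpread (stub_positivity)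

/-! ### Sub-level counting by supports (generic linear algebra) -/

/-- **Sub-level counting by supports.** For a Hermitian matrix `A`, a real level `E` and a finite
index set `X`: if every non-zero vector `v` with `Re⟨v, Av⟩ ≤ E Σ‖v_i‖²` has a non-zero coordinate in
`X`, then `A` has at most `|X|` eigenvalues (roots of its characteristic polynomial, with multiplicity)
below `E`.  Proof: the span `W` of the eigenvectors below `E` satisfies the sub-level inequality, so
restriction of coordinates `W → ℂ^X` is injective. -/
theorem countP_lt_le_card_of_support {n : Type*} [Fintype n] [DecidableEq n] {A : Matrix n n ℂ}
    (hA : A.IsHermitian) (E : ℝ) (X : Finset n)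
    (hX : ∀ v : n → ℂ, v ≠ 0 → (star v ⬝ᵥ (A *ᵥ v)).re ≤ E * ∑ i, ‖v i‖ ^ 2 → ∃ i ∈ X, v i ≠ 0) :
    A.charpoly.roots.countP (fun z => z.re < E) ≤ X.card := by
  set U : Matrix n n ℂ := (hA.eigenvectorUnitary : Matrix n n ℂ) with hU
  let J := {i // ¬ hA.eigenvalues i < E}
  let Φ : (n → ℂ) →ₗ[ℂ] (J → ℂ) :=
    (LinearMap.pi fun j : J => LinearMap.proj (R := ℂ) (φ := fun _ : n => ℂ) j.1) ∘ₗ Uᴴ.mulVecLin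
  let W : Submodule ℂ (n → ℂ) := LinearMap.ker Φ
  have hWmem : ∀ v ∈ W, ∀ j, ¬ hA.eigenvalues j < E → (Uᴴ *ᵥ v) j = 0 := by
    intro v hv j hj
    have := congrFun (LinearMap.mem_ker.1 hv) ⟨j, hj⟩
    simpa [Φ] using this
  -- `dim W ≥ #{λ < E}`
  have hWdim : (Finset.univ.filter fun i => hA.eigenvalues i < E).card ≤ Module.finrank ℂ W := by
    show _ ≤ Module.finrank ℂ (LinearMap.ker Φ)
    have h1 := Φ.finrank_range_add_finrank_ker
    have h2 : Module.finrank ℂ (LinearMap.range Φ) ≤ Fintype.card J := by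
      calc Module.finrank ℂ (LinearMap.range Φ) ≤ Module.finrank ℂ (J → ℂ) := Submodule.finrank_le _
        _ = Fintype.card J := Module.finrank_fintype_fun_eq_card ℂ
    have h3 : Module.finrank ℂ (n → ℂ) = Fintype.card n := Module.finrank_fintype_fun_eq_card ℂ
    have h4 : (Finset.univ.filter fun i => hA.eigenvalues i < E).card + Fintype.card J =
        Fintype.card n := by
      rw [Fintype.card_subtype_compl, Fintype.card_subtype,
        Nat.add_sub_cancel' (Finset.card_le_univ _)]
    omega
  -- on `W` the form is at most `E‖v‖²`
  have hWform : ∀ v ∈ W, (star v ⬝ᵥ (A *ᵥ v)).re ≤ E * ∑ i, ‖v i‖ ^ 2 := by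
    intro v hv
    set w := Uᴴ *ᵥ v with hw
    have hS := sum_norm_sq_eigenvectorUnitary_conjTranspose_mulVec hA v
    rw [← hU, ← hw] at hS
    rw [re_form_eq_sum_eigenvalues hA v, ← hU, ← hw, ← hS, Finset.mul_sum]
    refine Finset.sum_le_sum fun j _ => ?_
    by_cases hj : hA.eigenvalues j < E
    · exact mul_le_mul_of_nonneg_right hj.le (by positivity)
    · rw [hw, hWmem v hv j hj, norm_zero]
      simp
  -- restriction of coordinates to `X` is injective on `W`
  let R : W →ₗ[ℂ] (X → ℂ) :=
    (LinearMap.pi fun i : X => LinearMap.proj (R := ℂ) (φ := fun _ : n => ℂ) i.1) ∘ₗ W.subtype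
  have hR : Function.Injective R := by
    rw [← LinearMap.ker_eq_bot, LinearMap.ker_eq_bot']
    intro v hv
    by_contra hv0
    have hv0' : (v : n → ℂ) ≠ 0 := fun h => hv0 (Subtype.ext h)
    obtain ⟨i, hiX, hi⟩ := hX v hv0' (hWform v v.2)
    have := congrFun hv ⟨i, hiX⟩
    exact hi (by simpa [R] using this)
  have hfin := LinearMap.finrank_le_finrank_of_injective hR
  rw [Module.finrank_fintype_fun_eq_card ℂ, Fintype.card_coe] at hfin
  rw [countP_roots_eq_card_filter hA (· < E)]
  exact hWdim.trans hfin

/-! ### The Hermitian part of the massless Wilson–Dirac operator -/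

section HermitianPart

variable {L : ℕ} [NeZero L]

/-- The covariant Wilson energy of the line is the real part of the Wilson–Dirac form:
`dirichletForm U ψ = Re⟨ψ, D_W(U,0,1)ψ⟩` (Wilson positivity, tree `stub_positivity`). -/
theorem deep_dirichletForm_eq_re_form (U : GaugeConfig 4 L SU3) (ψ : QuarkIdx L → ℂ) :
    dirichletForm U ψ = (star ψ ⬝ᵥ (wilsonDirac (fundamentalRep (Fin 3)) U 0 1 *ᵥ ψ)).re := by
  rw [stub_positivity L U ψ, dirichletForm]
  refine congrArg _ (Finset.sum_congr rfl fun x _ => Finset.sum_congr rfl fun μ _ =>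
    Finset.sum_congr rfl fun a _ => Finset.sum_congr rfl fun α _ => ?_)
  rw [norm_sub_rev, fundamentalRep_apply]

/-- `⟨ψ, (D + Dᴴ) ψ⟩ = 2 · dirichletForm U ψ` for the massless Wilson–Dirac operator `D = D_W(U,0,1)`
(a real number; Wilson positivity). -/
theorem star_dotProduct_add_conjTranspose_wilsonDirac (U : GaugeConfig 4 L SU3) (ψ : QuarkIdx L → ℂ) :
    star ψ ⬝ᵥ ((wilsonDirac (fundamentalRep (Fin 3)) U 0 1 + (wilsonDirac (fundamentalRep (Fin 3)) U 0 1)ᴴ) *ᵥ ψ) =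
      ((2 * dirichletForm U ψ : ℝ) : ℂ) := by
  set D := wilsonDirac (fundamentalRep (Fin 3)) U 0 1 with hD
  have hconj : star ψ ⬝ᵥ (Dᴴ *ᵥ ψ) = star (star ψ ⬝ᵥ (D *ᵥ ψ)) := by
    rw [mulVec_conjTranspose, star_dotProduct_star, ← dotProduct_mulVec]
  rw [add_mulVec, dotProduct_add, hconj, Complex.star_def, Complex.add_conj, deep_dirichletForm_eq_re_form]

omit [NeZero L] in
/-- The Hermitian part `Re D_W = ½(D + Dᴴ)` of the massless Wilson–Dirac operator is Hermitian. -/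
theorem isHermitian_hermitianPart_wilsonDirac (U : GaugeConfig 4 L SU3) :
    ((1 / 2 : ℂ) • (wilsonDirac (fundamentalRep (Fin 3)) U 0 1 +
      (wilsonDirac (fundamentalRep (Fin 3)) U 0 1)ᴴ)).IsHermitian := by
  set D := wilsonDirac (fundamentalRep (Fin 3)) U 0 1 with hD
  have h : (D + Dᴴ).IsHermitian := isHermitian_add_transpose_self D
  unfold Matrix.IsHermitian at h ⊢
  rw [conjTranspose_smul, h]
  congr 1
  rw [Complex.star_def, map_div₀, map_one, map_ofNat]

/-- The form of the Hermitian part is the covariant Wilson energy: `⟨ψ, ½(D + Dᴴ)ψ⟩ = dirichletForm U ψ`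
(as the real part; the form is real). -/
theorem re_form_hermitianPart_wilsonDirac (U : GaugeConfig 4 L SU3) (ψ : QuarkIdx L → ℂ) :
    (star ψ ⬝ᵥ (((1 / 2 : ℂ) • (wilsonDirac (fundamentalRep (Fin 3)) U 0 1 +
      (wilsonDirac (fundamentalRep (Fin 3)) U 0 1)ᴴ)) *ᵥ ψ)).re = dirichletForm U ψ := by
  rw [smul_mulVec, dotProduct_smul, star_dotProduct_add_conjTranspose_wilsonDirac, smul_eq_mul]
  have : (1 / 2 : ℂ) * (((2 * dirichletForm U ψ : ℝ)) : ℂ) = ((dirichletForm U ψ : ℝ) : ℂ) := by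
    push_cast
    ring
  rw [this, Complex.ofReal_re]

/-- **`D_W(U,0,1) + D_W(U,0,1)ᴴ ⪰ 0`** (Wilson positivity): the hypothesis of Ky Fan counting. -/
theorem posSemidef_add_conjTranspose_wilsonDirac (U : GaugeConfig 4 L SU3) :
    (wilsonDirac (fundamentalRep (Fin 3)) U 0 1 + (wilsonDirac (fundamentalRep (Fin 3)) U 0 1)ᴴ).PosSemidef := by
  refine PosSemidef.of_dotProduct_mulVec_nonneg (isHermitian_add_transpose_self _) fun ψ => ?_
  rw [star_dotProduct_add_conjTranspose_wilsonDirac, Complex.zero_le_real]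
  exact mul_nonneg (by norm_num) (dirichletForm_nonneg U ψ)

/-! ### The deterministic count bound -/

/-- **Hermitian sub-level count from the flat-cube dichotomy.**  Given the flat-cube dichotomy (S4) as a
hypothesis: for every `SU(3)` link field `U` on `(ℤ/L)⁴`, every level `λ > 0` and block side `n ≥ 1` with
`n + 1 ≤ L` and `64 n² λ ≤ 1`, the number of eigenvalues of `Re D_W(U,0,1) = ½(D + Dᴴ)` below `λ` is at
most `12 (n+1)⁴` times the number of positions `t` whose block `t + {0,…,n}⁴` holds at least `n⁴/128`
lowest corners of `λ`-flat spatial unit cubes.  (Supports instead of IMS: a sub-level vector vanishing on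
all flat-rich blocks contradicts the dichotomy.) -/
theorem hermitianCount_le_of_dichotomy
    (hDich : ∀ (L : ℕ) [NeZero L] (U : GaugeConfig 4 L SU3) (ψ : QuarkIdx L → ℂ) (lam : ℝ) (n : ℕ),
      ψ ≠ 0 → 0 < lam → 1 ≤ n → n + 1 ≤ L → 64 * (n : ℝ) ^ 2 * lam ≤ 1 →
      dirichletForm U ψ ≤ lam * ∑ i, ‖ψ i‖ ^ 2 →
        ∃ t : TorusSite 4 L,
          (n : ℝ) ^ 4 / 128 ≤
            ((Finset.univ.filter fun s : Fin 4 → Fin (n + 1) =>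
                CubeFlat U (t + fun μ => ((s μ : ℕ) : ZMod L)) lam).card : ℝ) ∧
          ∃ (s : Fin 4 → Fin (n + 1)) (a : Fin 3) (α : Fin 4),
            ψ (t + (fun μ => ((s μ : ℕ) : ZMod L)), a, α) ≠ 0)
    (U : GaugeConfig 4 L SU3) {lam : ℝ} {n : ℕ} (hlam : 0 < lam) (hn : 1 ≤ n) (hnL : n + 1 ≤ L)
    (hsmall : 64 * (n : ℝ) ^ 2 * lam ≤ 1) :
    ((1 / 2 : ℂ) • (wilsonDirac (fundamentalRep (Fin 3)) U 0 1 +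
        (wilsonDirac (fundamentalRep (Fin 3)) U 0 1)ᴴ)).charpoly.roots.countP (fun z : ℂ => z.re < lam) ≤
      12 * (n + 1) ^ 4 *
        (Finset.univ.filter fun t : TorusSite 4 L => (n : ℝ) ^ 4 / 128 ≤
          ((Finset.univ.filter fun s : Fin 4 → Fin (n + 1) =>
            CubeFlat U (t + fun μ => ((s μ : ℕ) : ZMod L)) lam).card : ℝ)).card := by
  set D := wilsonDirac (fundamentalRep (Fin 3)) U 0 1 with hD
  set T := (Finset.univ.filter fun t : TorusSite 4 L => (n : ℝ) ^ 4 / 128 ≤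
    ((Finset.univ.filter fun s : Fin 4 → Fin (n + 1) =>
      CubeFlat U (t + fun μ => ((s μ : ℕ) : ZMod L)) lam).card : ℝ)) with hT
  -- the sites of the flat-rich blocks and the colour–spin indices over them
  set Xs : Finset (TorusSite 4 L) :=
    T.biUnion fun t => Finset.univ.image fun s : Fin 4 → Fin (n + 1) => t + fun μ => ((s μ : ℕ) : ZMod L)
    with hXs
  set X : Finset (QuarkIdx L) := Xs ×ˢ (Finset.univ : Finset (Fin 3 × Fin 4)) with hX
  have hXcard : X.card ≤ 12 * (n + 1) ^ 4 * T.card := by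
    have h1 : Xs.card ≤ T.card * (n + 1) ^ 4 := by
      refine Finset.card_biUnion_le_card_mul _ _ _ fun t _ => Finset.card_image_le.trans ?_
      rw [Finset.card_univ, Fintype.card_fun, Fintype.card_fin, Fintype.card_fin]
    have h2 : X.card = Xs.card * 12 := by
      rw [hX, Finset.card_product, Finset.card_univ, Fintype.card_prod, Fintype.card_fin, Fintype.card_fin]
    rw [h2]
    nlinarith
  refine le_trans ?_ hXcard
  refine countP_lt_le_card_of_support (isHermitian_hermitianPart_wilsonDirac U) lam X fun v hv hform => ?_
  rw [re_form_hermitianPart_wilsonDirac] at hform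
  obtain ⟨t, hrich, s, a, α, hne⟩ := hDich L U v lam n hv hlam hn hnL hsmall hform
  refine ⟨(t + fun μ => ((s μ : ℕ) : ZMod L), a, α), ?_, hne⟩
  rw [hX, Finset.mem_product]
  refine ⟨?_, Finset.mem_univ _⟩
  rw [hXs, Finset.mem_biUnion]
  refine ⟨t, ?_, Finset.mem_image.2 ⟨s, Finset.mem_univ _, rfl⟩⟩
  rw [hT, Finset.mem_filter]
  exact ⟨Finset.mem_univ _, hrich⟩

end HermitianPart

/-- **Real-root count of `D_W(U,0,1)` from Ky Fan counting and the flat-cube dichotomy** (both as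
hypotheses; the deterministic part of `stub_deep`).  For every `SU(3)` link field `U` on `(ℤ/L)⁴`,
every threshold `η > 0` and block side `n ≥ 1` with `n + 1 ≤ L`, `128 n² η ≤ 1`:
`#{real roots z of charpoly D_W(U,0,1), Re z < η} ≤ 24 (n+1)⁴ · #{flat-rich positions at level 2η}`
(Ky Fan: `≤ 2 ·#{eigenvalues of Re D_W below 2η}`; then `hermitianCount_le_of_dichotomy` at `λ = 2η`). -/
theorem realCount_le_of_kyFan_dichotomy :
    (∀ (n : Type) [Fintype n] [DecidableEq n] (D : Matrix n n ℂ) (η : ℝ), (D + Dᴴ).PosSemidef →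
      (D.charpoly.roots.countP (fun z : ℂ => z.re < η) : ℝ) ≤
        2 * (((1 / 2 : ℂ) • (D + Dᴴ)).charpoly.roots.countP (fun z : ℂ => z.re < 2 * η) : ℝ)) →
    (∀ (L : ℕ) [NeZero L] (U : GaugeConfig 4 L SU3) (ψ : QuarkIdx L → ℂ) (lam : ℝ) (n : ℕ),
      ψ ≠ 0 → 0 < lam → 1 ≤ n → n + 1 ≤ L → 64 * (n : ℝ) ^ 2 * lam ≤ 1 →
      dirichletForm U ψ ≤ lam * ∑ i, ‖ψ i‖ ^ 2 →
        ∃ t : TorusSite 4 L,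
          (n : ℝ) ^ 4 / 128 ≤
            ((Finset.univ.filter fun s : Fin 4 → Fin (n + 1) =>
                CubeFlat U (t + fun μ => ((s μ : ℕ) : ZMod L)) lam).card : ℝ) ∧
          ∃ (s : Fin 4 → Fin (n + 1)) (a : Fin 3) (α : Fin 4),
            ψ (t + (fun μ => ((s μ : ℕ) : ZMod L)), a, α) ≠ 0) →
    ∀ (L : ℕ) [NeZero L] (U : GaugeConfig 4 L SU3) (η : ℝ) (n : ℕ),
      0 < η → 1 ≤ n → n + 1 ≤ L → 128 * (n : ℝ) ^ 2 * η ≤ 1 →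
      ((wilsonDirac (fundamentalRep (Fin 3)) U 0 1).charpoly.roots.countP
          (fun z : ℂ => z.im = 0 ∧ z.re < η) : ℝ) ≤
        24 * ((n : ℝ) + 1) ^ 4 *
          ((Finset.univ.filter fun t : TorusSite 4 L => (n : ℝ) ^ 4 / 128 ≤
            ((Finset.univ.filter fun s : Fin 4 → Fin (n + 1) =>
              CubeFlat U (t + fun μ => ((s μ : ℕ) : ZMod L)) (2 * η)).card : ℝ)).card : ℝ) := by
  intro hKF hDich L _ U η n hη hn hnL hsmall
  set D := wilsonDirac (fundamentalRep (Fin 3)) U 0 1 with hD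
  -- drop the reality condition
  have h1 : D.charpoly.roots.countP (fun z : ℂ => z.im = 0 ∧ z.re < η) ≤
      D.charpoly.roots.countP (fun z : ℂ => z.re < η) := by
    rw [Multiset.countP_eq_card_filter, Multiset.countP_eq_card_filter]
    exact Multiset.card_le_card (Multiset.monotone_filter_right _ fun z hz => hz.2)
  -- Ky Fan
  have h2 := hKF (QuarkIdx L) D η (posSemidef_add_conjTranspose_wilsonDirac U)
  -- the dichotomy count at level `2η`
  have hlam : 0 < 2 * η := by linarith
  have hsmall' : 64 * (n : ℝ) ^ 2 * (2 * η) ≤ 1 := by linarith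
  have h3 := hermitianCount_le_of_dichotomy hDich U hlam hn hnL hsmall'
  rw [← hD] at h3
  have h1' : (D.charpoly.roots.countP (fun z : ℂ => z.im = 0 ∧ z.re < η) : ℝ) ≤
      (D.charpoly.roots.countP (fun z : ℂ => z.re < η) : ℝ) := by exact_mod_cast h1
  have h3' : (((1 / 2 : ℂ) • (D + Dᴴ)).charpoly.roots.countP (fun z : ℂ => z.re < 2 * η) : ℝ) ≤
      ((12 * (n + 1) ^ 4 * (Finset.univ.filter fun t : TorusSite 4 L => (n : ℝ) ^ 4 / 128 ≤
          ((Finset.univ.filter fun s : Fin 4 → Fin (n + 1) =>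
            CubeFlat U (t + fun μ => ((s μ : ℕ) : ZMod L)) (2 * η)).card : ℝ)).card : ℕ) : ℝ) := by
    exact_mod_cast h3
  push_cast at h3'
  linarith

end Summit.QuantumFields.QCD.Cruxes.WindowExtinction.ChessboardColdCells

end
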